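import Summits.Parity.GeneralizedHardyLittlewood.Theorems.BeyondDiagonalBeatsQuarter.KernelFormXSq
import HarnessLib

/-!
# Route `PrimeLevelFamEdge`, crux K_A `MomentsBeyondDiagonal` (stmt-Parity-20007), line «petersson_layers» v4, stub `stub_diag`:
# **the harmonic engine `H_a(x) = Σ_{n≤x} |W(n)|E_n logᵃ(x/n) = ζ(2)·log^{a+1}x/(a+1) + O_a((1+log x)ᵃ)`**

Census item G5 (first half) of the `stub_diag` repair census (`Lines/petersson_layers_stub_diag_g4_bricks.md`). In the
kernel form of a general profile `P` (`quadForm_profile_eq`), every main term is an `n`-sum against the measure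
`φ(n)W(n)²E_n² = ζ(2)|W(n)|E_n` (`= ζ(2)²μ²(n)/φ(n)`) with a polynomial weight in `u_n = log(M/n)/log M` (the weight
`P″(u_n)²` for the `L`-term, `P″(u_n)P′(u_n)` for the prime term). Expanding the weight in powers of `log(M/n)`, what
is needed is the family of weighted harmonic sums `H_a(x) = Σ_{n≤x}|W(n)|E_n logᵃ(x/n)` to RELATIVE precision
`O(1/log x)`. No two-sided estimate for `Σ μ²/φ` is imported: everything comes out of the `X²` chain's exact collapses.

* `sum_absW_mainConst_le` — crude: `0 ≤ H_0(x) ≤ C(2 + log x)` (`x ≥ 1`);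
* `abs_sum_absW_mainConst_sub_le` — **`a = 0`: `|H_0(x) − ζ(2)log x| ≤ C`** (`x ≥ 1`): the collapse
  `Σ|W|S(x/n;n) = W₂(x)` (`KernelFormXSqCollapse`), `S = 2E_n + O(D(n)/(1+log(x/n))²)` (`KernelFormXSqCore`), the dyadic
  sum (`KernelFormXSqSums`) and `W₂ = 2ζ(2)log x + O(1)` (`abs_weightLogPowSum_sub_le`);
* `abs_sum_absW_mainConst_log_sub_le` — **`a = 1`: `|H_1(x) − ζ(2)log²x/2| ≤ C(1 + log x)`**: the collapse
  `Σ|W|log n·S = W₃ − log x·W₂` and `W₃ = 3ζ(2)log²x + O(log x)`;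
* every order `a ≥ 2` follows by the integral recursion `H_{a+1}(x) = (a+1)∫₁ˣ H_a(w)dw/w` in the companion file
  `…DiagHarmonicPow` (`abs_sum_absW_mainConst_log_pow_sub_le`).

Def-free; theorems only. Helper `--supports stmt-Parity-20007`; closes nothing; K_A, K_B and the Parity summit are
NOT proved; nothing about Landau–Siegel zeros.

## References
* E. Kowalski, P. Michel, J. VanderKam, J. reine angew. Math. 526 (2000), Prop. 5.1 p. 18 (the `n`-sums behind (31)).
  [cite: KowalskiMichelVanderKam2000, Prop. 5.1 — derivation]
* H. L. Montgomery, R. C. Vaughan, *Multiplicative Number Theory I*, CUP 2007, §5.1 (Riesz typical means).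
  [cite: MontgomeryVaughan2007, §5.1 — derivation]
-/

noncomputable section

open scoped Real ArithmeticFunction.Moebius ArithmeticFunction.sigma ArithmeticFunction.zeta
open Finset ArithmeticFunction

namespace Summit.Parity.GeneralizedHardyLittlewood.Theorems.MomentsBeyondDiagonal.DiagKernel

open Literature.NumberTheory.LFunctions Literature.NumberTheory.LFunctions.KMV2000
open MollifierMainTerm (W weightLogPowSum abs_weightLogPowSum_sub_le)
open Summit.Parity.GeneralizedHardyLittlewood.Theorems.BeyondDiagonalBeatsQuarter.KernelFormXSq
  (coprimeSum mainConst divWeight divWeight_nonneg one_le_divWeight mainConst_nonneg mainConst_le_divWeight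
    abs_coprimeSum_sub_le abs_W_le sum_absW_coprimeSum sum_absW_log_coprimeSum sum_divWeight_sq_div_le
    sum_divWeight_sq_dyadic_le)

/-! ### Pointwise sizes -/

/-- `|W(n)|·E_n ≤ C_E·D(n)²/n` (`|W(n)| ≤ 1/n`, `E_n ≤ C_E D(n) ≤ C_E D(n)²`). [folklore] -/
theorem absW_mul_mainConst_le {C_E : ℝ} (hE : ∀ n : ℕ, n ≠ 0 → mainConst n ≤ C_E * divWeight n)
    {n : ℕ} (hn : n ≠ 0) : |W n| * mainConst n ≤ C_E * (divWeight n ^ 2 / n) := by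
  have hn0 : (0 : ℝ) < n := by exact_mod_cast Nat.pos_of_ne_zero hn
  have hD1 := one_le_divWeight hn
  have hD := divWeight_nonneg n
  have hEn := hE n hn
  have hCE : 0 ≤ C_E := by
    have := mainConst_nonneg n
    nlinarith
  have hDsq : divWeight n ≤ divWeight n ^ 2 := by nlinarith
  calc |W n| * mainConst n ≤ (n : ℝ)⁻¹ * (C_E * divWeight n) :=
        mul_le_mul (abs_W_le n) hEn (mainConst_nonneg n) (by positivity)
    _ ≤ (n : ℝ)⁻¹ * (C_E * divWeight n ^ 2) := by gcongr
    _ = C_E * (divWeight n ^ 2 / n) := by rw [div_eq_mul_inv]; ring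

/-- The error weight: `|W(n)|·(C_δ D(n)/(1+log(x/n))²) ≤ C_δ·D(n)²/(n(1+log(x/n))²)` (`n ≤ x`). [folklore] -/
theorem absW_mul_err_le {C_δ : ℝ} (hC : 0 ≤ C_δ) {x : ℝ} {n : ℕ} (hn : n ≠ 0) (hnx : (n : ℝ) ≤ x) :
    |W n| * (C_δ * divWeight n / (1 + Real.log (x / n)) ^ 2) ≤
      C_δ * (divWeight n ^ 2 / (n * (1 + Real.log (x / n)) ^ 2)) := by
  have hn0 : (0 : ℝ) < n := by exact_mod_cast Nat.pos_of_ne_zero hn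
  have hD1 := one_le_divWeight hn
  have hD := divWeight_nonneg n
  have hy : 0 ≤ Real.log (x / n) := Real.log_nonneg ((one_le_div hn0).2 hnx)
  have hDsq : divWeight n ≤ divWeight n ^ 2 := by nlinarith
  calc |W n| * (C_δ * divWeight n / (1 + Real.log (x / n)) ^ 2)
      ≤ (n : ℝ)⁻¹ * (C_δ * divWeight n ^ 2 / (1 + Real.log (x / n)) ^ 2) := by
        refine mul_le_mul (abs_W_le n) ?_ (by positivity) (by positivity)
        gcongr
    _ = C_δ * (divWeight n ^ 2 / (n * (1 + Real.log (x / n)) ^ 2)) := by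
        field_simp

/-! ### Crude size of `H_0` -/

/-- **`0 ≤ Σ_{n≤x}|W(n)|E_n ≤ C(2 + log x)`** for `x ≥ 1` (`Σ_{n≤N}D(n)²/n ≤ Z₂(2 + log N)`). [folklore] -/
theorem sum_absW_mainConst_le :
    ∃ C : ℝ, 0 < C ∧ ∀ x : ℝ, 1 ≤ x →
      0 ≤ ∑ n ∈ Icc 1 ⌊x⌋₊, |W n| * mainConst n ∧
        ∑ n ∈ Icc 1 ⌊x⌋₊, |W n| * mainConst n ≤ C * (2 + Real.log x) := by
  obtain ⟨C_E, hC_E, hE⟩ := mainConst_le_divWeight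
  set Z : ℝ := (∑' d : ℕ, (d : ℝ) ^ (-(5 / 4 : ℝ))) ^ 2 with hZ
  refine ⟨C_E * Z + 1, by positivity, fun x hx ↦ ⟨Finset.sum_nonneg fun n _ ↦
    mul_nonneg (abs_nonneg _) (mainConst_nonneg n), ?_⟩⟩
  have hx0 : 0 < x := by linarith
  set N := ⌊x⌋₊ with hN
  have hN1 : 1 ≤ N := Nat.le_floor (by simpa using hx)
  have hNx : (N : ℝ) ≤ x := Nat.floor_le hx0.le
  have hlogN : Real.log N ≤ Real.log x := Real.log_le_log (by exact_mod_cast hN1) hNx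
  have hlx : 0 ≤ Real.log x := Real.log_nonneg hx
  have h1 : ∑ n ∈ Icc 1 N, |W n| * mainConst n ≤ C_E * ∑ n ∈ Icc 1 N, divWeight n ^ 2 / n := by
    rw [Finset.mul_sum]
    refine Finset.sum_le_sum fun n hn ↦ ?_
    exact absW_mul_mainConst_le hE (by have := (Finset.mem_Icc.1 hn).1; omega)
  have h2 := sum_divWeight_sq_div_le hN1
  calc ∑ n ∈ Icc 1 N, |W n| * mainConst n ≤ C_E * (Z * (2 + Real.log N)) := h1.trans (by gcongr)
    _ ≤ C_E * (Z * (2 + Real.log x)) := by gcongr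
    _ ≤ (C_E * Z + 1) * (2 + Real.log x) := by nlinarith [hZ ▸ sq_nonneg (∑' d : ℕ, (d : ℝ) ^ (-(5 / 4 : ℝ)))]

/-! ### `a = 0`: `H_0(x) = ζ(2)log x + O(1)` -/

/-- The collapse rearranged: `2Σ_{n≤x}|W(n)|E_n = W₂(x) − Σ_{n≤x}|W(n)|(S(x/n;n) − 2E_n)`. [folklore] -/
theorem two_mul_sum_absW_mainConst_eq (x : ℝ) :
    2 * ∑ n ∈ Icc 1 ⌊x⌋₊, |W n| * mainConst n =
      weightLogPowSum 2 x - ∑ n ∈ Icc 1 ⌊x⌋₊, |W n| * (coprimeSum n (x / n) - 2 * mainConst n) := by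
  rw [← sum_absW_coprimeSum x, ← Finset.sum_sub_distrib, Finset.mul_sum]
  refine Finset.sum_congr rfl fun n _ ↦ ?_
  ring

/-- The error of the collapse: `|Σ_{n≤x}|W(n)|(S(x/n;n) − 2E_n)| ≤ 8C_δZ₂` for `x ≥ 1`. [folklore] -/
theorem abs_sum_absW_mul_coprimeSum_sub_le :
    ∃ C : ℝ, 0 < C ∧ ∀ x : ℝ, 1 ≤ x →
      |∑ n ∈ Icc 1 ⌊x⌋₊, |W n| * (coprimeSum n (x / n) - 2 * mainConst n)| ≤ C := by
  obtain ⟨C_δ, hC_δ, hδ⟩ := abs_coprimeSum_sub_le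
  set Z : ℝ := (∑' d : ℕ, (d : ℝ) ^ (-(5 / 4 : ℝ))) ^ 2 with hZ
  refine ⟨8 * C_δ * Z + 1, by positivity, fun x hx ↦ ?_⟩
  have hx0 : 0 < x := by linarith
  have hterm : ∀ n ∈ Icc 1 ⌊x⌋₊, |(|W n| * (coprimeSum n (x / n) - 2 * mainConst n))| ≤
      C_δ * (divWeight n ^ 2 / (n * (1 + Real.log (x / n)) ^ 2)) := by
    intro n hn
    have hn' := Finset.mem_Icc.1 hn
    have hn0 : n ≠ 0 := by omega
    have hnx : (n : ℝ) ≤ x := (Nat.le_floor_iff hx0.le).1 hn'.2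
    have hn1 : (1 : ℝ) ≤ n := by exact_mod_cast hn'.1
    have hy1 : 1 ≤ x / n := (one_le_div (by linarith)).2 hnx
    rw [abs_mul, abs_abs]
    exact (mul_le_mul_of_nonneg_left (hδ n hn0 _ hy1) (abs_nonneg _)).trans (absW_mul_err_le hC_δ.le hn0 hnx)
  calc |∑ n ∈ Icc 1 ⌊x⌋₊, |W n| * (coprimeSum n (x / n) - 2 * mainConst n)|
      ≤ ∑ n ∈ Icc 1 ⌊x⌋₊, |(|W n| * (coprimeSum n (x / n) - 2 * mainConst n))| := Finset.abs_sum_le_sum_abs _ _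
    _ ≤ ∑ n ∈ Icc 1 ⌊x⌋₊, C_δ * (divWeight n ^ 2 / (n * (1 + Real.log (x / n)) ^ 2)) := Finset.sum_le_sum hterm
    _ = C_δ * ∑ n ∈ Icc 1 ⌊x⌋₊, divWeight n ^ 2 / (n * (1 + Real.log (x / n)) ^ 2) := by rw [Finset.mul_sum]
    _ ≤ C_δ * (8 * Z) := mul_le_mul_of_nonneg_left (sum_divWeight_sq_dyadic_le hx) hC_δ.le
    _ ≤ 8 * C_δ * Z + 1 := by linarith

/-- **`a = 0`: `|Σ_{n≤x}|W(n)|E_n − ζ(2)log x| ≤ C`** for all `x ≥ 1` (`ζ(2) = π²/6`). For `x ≥ 3` this is the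
collapse `2H_0 = W₂ − Σ|W|(S − 2E)` with `W₂(x) = 2ζ(2)log x + O(1)`; for `1 ≤ x < 3` both sides are bounded.
[cite: KowalskiMichelVanderKam2000, Prop. 5.1 — derivation (the measure `ζ(2)μ²/φ` of the `n`-sum)] -/
theorem abs_sum_absW_mainConst_sub_le :
    ∃ C : ℝ, 0 < C ∧ ∀ x : ℝ, 1 ≤ x →
      |∑ n ∈ Icc 1 ⌊x⌋₊, |W n| * mainConst n - π ^ 2 / 6 * Real.log x| ≤ C := by
  obtain ⟨C_W, hW⟩ := abs_weightLogPowSum_sub_le (j := 2) le_rfl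
  obtain ⟨C_δ, hC_δ, hδ⟩ := abs_sum_absW_mul_coprimeSum_sub_le
  obtain ⟨C_c, hC_c, hc⟩ := sum_absW_mainConst_le
  refine ⟨|C_W| / 2 + C_δ / 2 + 4 * C_c + π ^ 2 / 6 * 2 + 1, by positivity, fun x hx ↦ ?_⟩
  have hx0 : 0 < x := by linarith
  have hlx : 0 ≤ Real.log x := Real.log_nonneg hx
  by_cases h3 : 3 ≤ x
  · -- the collapse
    have hW' : |weightLogPowSum 2 x - π ^ 2 / 6 * 2 * Real.log x| ≤ |C_W| := by
      have := hW x h3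
      norm_num at this
      exact this.trans (le_abs_self _)
    have hδ' := hδ x hx
    have key : ∑ n ∈ Icc 1 ⌊x⌋₊, |W n| * mainConst n - π ^ 2 / 6 * Real.log x =
        (weightLogPowSum 2 x - π ^ 2 / 6 * 2 * Real.log x) / 2 -
          (∑ n ∈ Icc 1 ⌊x⌋₊, |W n| * (coprimeSum n (x / n) - 2 * mainConst n)) / 2 := by
      have := two_mul_sum_absW_mainConst_eq x
      linarith
    rw [key]
    calc |(weightLogPowSum 2 x - π ^ 2 / 6 * 2 * Real.log x) / 2 -
            (∑ n ∈ Icc 1 ⌊x⌋₊, |W n| * (coprimeSum n (x / n) - 2 * mainConst n)) / 2|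
        ≤ |(weightLogPowSum 2 x - π ^ 2 / 6 * 2 * Real.log x) / 2| +
            |(∑ n ∈ Icc 1 ⌊x⌋₊, |W n| * (coprimeSum n (x / n) - 2 * mainConst n)) / 2| := abs_sub _ _
      _ ≤ |C_W| / 2 + C_δ / 2 := by
          rw [abs_div, abs_div, abs_two]
          gcongr
      _ ≤ |C_W| / 2 + C_δ / 2 + 4 * C_c + π ^ 2 / 6 * 2 + 1 := by nlinarith [Real.pi_pos]
  · -- small `x`: both sides bounded
    rw [not_le] at h3
    have hl2 : Real.log x ≤ 2 := by
      have := Real.log_le_sub_one_of_pos hx0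
      linarith
    obtain ⟨h0, h1⟩ := hc x hx
    calc |∑ n ∈ Icc 1 ⌊x⌋₊, |W n| * mainConst n - π ^ 2 / 6 * Real.log x|
        ≤ |∑ n ∈ Icc 1 ⌊x⌋₊, |W n| * mainConst n| + |π ^ 2 / 6 * Real.log x| := abs_sub _ _
      _ = ∑ n ∈ Icc 1 ⌊x⌋₊, |W n| * mainConst n + π ^ 2 / 6 * Real.log x := by
          rw [abs_of_nonneg h0, abs_of_nonneg (by positivity)]
      _ ≤ C_c * (2 + 2) + π ^ 2 / 6 * 2 := by
          have : C_c * (2 + Real.log x) ≤ C_c * (2 + 2) := by gcongr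
          nlinarith [Real.pi_pos]
      _ ≤ |C_W| / 2 + C_δ / 2 + 4 * C_c + π ^ 2 / 6 * 2 + 1 := by
          have := abs_nonneg C_W
          nlinarith

/-! ### `a = 1`: `H_1(x) = ζ(2)log²x/2 + O(log x)` -/

/-- The logarithmic collapse rearranged:
`2Σ_{n≤x}|W(n)|E_n log n = (W₃(x) − log x·W₂(x)) − Σ_{n≤x}|W(n)|log n·(S(x/n;n) − 2E_n)` (`x > 0`). [folklore] -/
theorem two_mul_sum_absW_mainConst_log_eq {x : ℝ} (hx : 0 < x) :
    2 * ∑ n ∈ Icc 1 ⌊x⌋₊, |W n| * mainConst n * Real.log n =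
      (weightLogPowSum 3 x - Real.log x * weightLogPowSum 2 x) -
        ∑ n ∈ Icc 1 ⌊x⌋₊, |W n| * Real.log n * (coprimeSum n (x / n) - 2 * mainConst n) := by
  rw [← sum_absW_log_coprimeSum hx, ← Finset.sum_sub_distrib, Finset.mul_sum]
  refine Finset.sum_congr rfl fun n _ ↦ ?_
  ring

/-- The error of the logarithmic collapse: `|Σ_{n≤x}|W(n)|log n·(S(x/n;n) − 2E_n)| ≤ 8C_δZ₂·log x`
for `x ≥ 1`. [folklore] -/
theorem abs_sum_absW_log_mul_coprimeSum_sub_le :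
    ∃ C : ℝ, 0 < C ∧ ∀ x : ℝ, 1 ≤ x →
      |∑ n ∈ Icc 1 ⌊x⌋₊, |W n| * Real.log n * (coprimeSum n (x / n) - 2 * mainConst n)| ≤
        C * Real.log x := by
  obtain ⟨C_δ, hC_δ, hδ⟩ := abs_coprimeSum_sub_le
  set Z : ℝ := (∑' d : ℕ, (d : ℝ) ^ (-(5 / 4 : ℝ))) ^ 2 with hZ
  refine ⟨8 * C_δ * Z + 1, by positivity, fun x hx ↦ ?_⟩
  have hx0 : 0 < x := by linarith
  have hlx : 0 ≤ Real.log x := Real.log_nonneg hx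
  have hterm : ∀ n ∈ Icc 1 ⌊x⌋₊, |(|W n| * Real.log n * (coprimeSum n (x / n) - 2 * mainConst n))| ≤
      Real.log x * (C_δ * (divWeight n ^ 2 / (n * (1 + Real.log (x / n)) ^ 2))) := by
    intro n hn
    have hn' := Finset.mem_Icc.1 hn
    have hn0 : n ≠ 0 := by omega
    have hnx : (n : ℝ) ≤ x := (Nat.le_floor_iff hx0.le).1 hn'.2
    have hn1 : (1 : ℝ) ≤ n := by exact_mod_cast hn'.1
    have hy1 : 1 ≤ x / n := (one_le_div (by linarith)).2 hnx
    have hlogn : 0 ≤ Real.log n := Real.log_nonneg hn1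
    have hlognx : Real.log n ≤ Real.log x := Real.log_le_log (by linarith) hnx
    rw [show |W n| * Real.log n * (coprimeSum n (x / n) - 2 * mainConst n) =
      Real.log n * (|W n| * (coprimeSum n (x / n) - 2 * mainConst n)) by ring, abs_mul,
      abs_of_nonneg hlogn, abs_mul, abs_abs]
    refine mul_le_mul hlognx ?_ (by positivity) hlx
    exact (mul_le_mul_of_nonneg_left (hδ n hn0 _ hy1) (abs_nonneg _)).trans (absW_mul_err_le hC_δ.le hn0 hnx)
  calc |∑ n ∈ Icc 1 ⌊x⌋₊, |W n| * Real.log n * (coprimeSum n (x / n) - 2 * mainConst n)|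
      ≤ ∑ n ∈ Icc 1 ⌊x⌋₊, |(|W n| * Real.log n * (coprimeSum n (x / n) - 2 * mainConst n))| :=
        Finset.abs_sum_le_sum_abs _ _
    _ ≤ ∑ n ∈ Icc 1 ⌊x⌋₊, Real.log x * (C_δ * (divWeight n ^ 2 / (n * (1 + Real.log (x / n)) ^ 2))) :=
        Finset.sum_le_sum hterm
    _ = Real.log x * (C_δ * ∑ n ∈ Icc 1 ⌊x⌋₊, divWeight n ^ 2 / (n * (1 + Real.log (x / n)) ^ 2)) := by
        rw [Finset.mul_sum, Finset.mul_sum]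
    _ ≤ Real.log x * (C_δ * (8 * Z)) := by
        refine mul_le_mul_of_nonneg_left (mul_le_mul_of_nonneg_left (sum_divWeight_sq_dyadic_le hx) hC_δ.le) hlx
    _ ≤ (8 * C_δ * Z + 1) * Real.log x := by nlinarith

/-- `H_1(x) = log x·H_0(x) − Σ_{n≤x}|W(n)|E_n log n` (`x > 0`). [folklore] -/
theorem sum_absW_mainConst_log_div_eq {x : ℝ} (hx : 0 < x) :
    ∑ n ∈ Icc 1 ⌊x⌋₊, |W n| * mainConst n * Real.log (x / n) =
      Real.log x * ∑ n ∈ Icc 1 ⌊x⌋₊, |W n| * mainConst n -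
        ∑ n ∈ Icc 1 ⌊x⌋₊, |W n| * mainConst n * Real.log n := by
  rw [Finset.mul_sum, ← Finset.sum_sub_distrib]
  refine Finset.sum_congr rfl fun n hn ↦ ?_
  have hn0 : (n : ℝ) ≠ 0 := by exact_mod_cast (show n ≠ 0 by have := (Finset.mem_Icc.1 hn).1; omega)
  rw [Real.log_div hx.ne' hn0]
  ring

/-- **`a = 1`: `|Σ_{n≤x}|W(n)|E_n log(x/n) − ζ(2)log²x/2| ≤ C(1 + log x)`** for all `x ≥ 1`. For `x ≥ 3`:
`H_1 = log x·H_0 − ½(W₃ − log x·W₂) + ½Σ|W|log n(S − 2E)` with `W₃ = 3ζ(2)log²x + O(log x)`,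
`W₂ = 2ζ(2)log x + O(1)`; for `1 ≤ x < 3` both sides are bounded.
[cite: KowalskiMichelVanderKam2000, Prop. 5.1 — derivation (the `n`-sum with one logarithm)] -/
theorem abs_sum_absW_mainConst_log_sub_le :
    ∃ C : ℝ, 0 < C ∧ ∀ x : ℝ, 1 ≤ x →
      |∑ n ∈ Icc 1 ⌊x⌋₊, |W n| * mainConst n * Real.log (x / n) - π ^ 2 / 6 * Real.log x ^ 2 / 2| ≤
        C * (1 + Real.log x) := by
  obtain ⟨C_W2, hW2⟩ := abs_weightLogPowSum_sub_le (j := 2) le_rfl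
  obtain ⟨C_W3, hW3⟩ := abs_weightLogPowSum_sub_le (j := 3) (by norm_num)
  obtain ⟨C₀, hC₀, h0⟩ := abs_sum_absW_mainConst_sub_le
  obtain ⟨C_δ, hC_δ, hδ⟩ := abs_sum_absW_log_mul_coprimeSum_sub_le
  obtain ⟨C_c, hC_c, hc⟩ := sum_absW_mainConst_le
  refine ⟨C₀ + |C_W3| / 2 + |C_W2| / 2 + C_δ / 2 + 8 * C_c + π ^ 2 / 6 * 2 + 1, by positivity,
    fun x hx ↦ ?_⟩
  have hx0 : 0 < x := by linarith
  have hlx : 0 ≤ Real.log x := Real.log_nonneg hx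
  set ℓ := Real.log x with hℓ
  set H₀ := ∑ n ∈ Icc 1 ⌊x⌋₊, |W n| * mainConst n with hH₀
  by_cases h3 : 3 ≤ x
  · have hW2' : |weightLogPowSum 2 x - π ^ 2 / 6 * 2 * ℓ| ≤ |C_W2| := by
      have := hW2 x h3
      norm_num at this
      exact this.trans (le_abs_self _)
    have hW3' : |weightLogPowSum 3 x - π ^ 2 / 6 * 3 * ℓ ^ 2| ≤ |C_W3| * ℓ := by
      have := hW3 x h3
      norm_num at this
      exact this.trans (mul_le_mul_of_nonneg_right (le_abs_self _) hlx)
    have h0' := h0 x hx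
    have hδ' := hδ x hx
    have key : ∑ n ∈ Icc 1 ⌊x⌋₊, |W n| * mainConst n * Real.log (x / n) - π ^ 2 / 6 * ℓ ^ 2 / 2 =
        ℓ * (H₀ - π ^ 2 / 6 * ℓ) -
          ((weightLogPowSum 3 x - π ^ 2 / 6 * 3 * ℓ ^ 2) - ℓ * (weightLogPowSum 2 x - π ^ 2 / 6 * 2 * ℓ)) / 2 +
          (∑ n ∈ Icc 1 ⌊x⌋₊, |W n| * Real.log n * (coprimeSum n (x / n) - 2 * mainConst n)) / 2 := by
      rw [sum_absW_mainConst_log_div_eq hx0]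
      have := two_mul_sum_absW_mainConst_log_eq hx0
      simp only [← hℓ, ← hH₀] at this ⊢
      linarith
    rw [key]
    have hA : |ℓ * (H₀ - π ^ 2 / 6 * ℓ)| ≤ ℓ * C₀ := by
      rw [abs_mul, abs_of_nonneg hlx]
      exact mul_le_mul_of_nonneg_left h0' hlx
    have hB : |((weightLogPowSum 3 x - π ^ 2 / 6 * 3 * ℓ ^ 2) -
        ℓ * (weightLogPowSum 2 x - π ^ 2 / 6 * 2 * ℓ)) / 2| ≤ (|C_W3| * ℓ + ℓ * |C_W2|) / 2 := by
      rw [abs_div, abs_two]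
      refine div_le_div_of_nonneg_right ((abs_sub _ _).trans (add_le_add hW3' ?_)) zero_le_two
      rw [abs_mul, abs_of_nonneg hlx]
      exact mul_le_mul_of_nonneg_left hW2' hlx
    have hC : |(∑ n ∈ Icc 1 ⌊x⌋₊, |W n| * Real.log n * (coprimeSum n (x / n) - 2 * mainConst n)) / 2| ≤
        C_δ * ℓ / 2 := by
      rw [abs_div, abs_two]
      exact div_le_div_of_nonneg_right hδ' zero_le_two
    calc |ℓ * (H₀ - π ^ 2 / 6 * ℓ) -
            ((weightLogPowSum 3 x - π ^ 2 / 6 * 3 * ℓ ^ 2) - ℓ * (weightLogPowSum 2 x - π ^ 2 / 6 * 2 * ℓ)) / 2 +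
            (∑ n ∈ Icc 1 ⌊x⌋₊, |W n| * Real.log n * (coprimeSum n (x / n) - 2 * mainConst n)) / 2|
        = |ℓ * (H₀ - π ^ 2 / 6 * ℓ) +
            -(((weightLogPowSum 3 x - π ^ 2 / 6 * 3 * ℓ ^ 2) - ℓ * (weightLogPowSum 2 x - π ^ 2 / 6 * 2 * ℓ)) / 2) +
            (∑ n ∈ Icc 1 ⌊x⌋₊, |W n| * Real.log n * (coprimeSum n (x / n) - 2 * mainConst n)) / 2| := by
          rw [sub_eq_add_neg]
      _ ≤ |ℓ * (H₀ - π ^ 2 / 6 * ℓ)| +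
            |-(((weightLogPowSum 3 x - π ^ 2 / 6 * 3 * ℓ ^ 2) - ℓ * (weightLogPowSum 2 x - π ^ 2 / 6 * 2 * ℓ)) / 2)| +
            |(∑ n ∈ Icc 1 ⌊x⌋₊, |W n| * Real.log n * (coprimeSum n (x / n) - 2 * mainConst n)) / 2| :=
          abs_add_three _ _ _
      _ = |ℓ * (H₀ - π ^ 2 / 6 * ℓ)| +
            |((weightLogPowSum 3 x - π ^ 2 / 6 * 3 * ℓ ^ 2) - ℓ * (weightLogPowSum 2 x - π ^ 2 / 6 * 2 * ℓ)) / 2| +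
            |(∑ n ∈ Icc 1 ⌊x⌋₊, |W n| * Real.log n * (coprimeSum n (x / n) - 2 * mainConst n)) / 2| := by
          rw [abs_neg]
      _ ≤ ℓ * C₀ + (|C_W3| * ℓ + ℓ * |C_W2|) / 2 + C_δ * ℓ / 2 := add_le_add (add_le_add hA hB) hC
      _ ≤ (C₀ + |C_W3| / 2 + |C_W2| / 2 + C_δ / 2 + 8 * C_c + π ^ 2 / 6 * 2 + 1) * (1 + ℓ) := by
          have h1 : 0 ≤ |C_W3| := abs_nonneg _
          have h2 : 0 ≤ |C_W2| := abs_nonneg _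
          nlinarith [Real.pi_pos, sq_nonneg π]
  · rw [not_le] at h3
    have hl2 : ℓ ≤ 2 := by
      have := Real.log_le_sub_one_of_pos hx0
      simp only [← hℓ] at this
      linarith
    obtain ⟨hc0, hc1⟩ := hc x hx
    have hH1 : 0 ≤ ∑ n ∈ Icc 1 ⌊x⌋₊, |W n| * mainConst n * Real.log (x / n) :=
      Finset.sum_nonneg fun n hn ↦ by
        have hn' := Finset.mem_Icc.1 hn
        have hn0 : (0 : ℝ) < n := by exact_mod_cast hn'.1
        have hnx : (n : ℝ) ≤ x := (Nat.le_floor_iff hx0.le).1 hn'.2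
        exact mul_nonneg (mul_nonneg (abs_nonneg _) (mainConst_nonneg n))
          (Real.log_nonneg ((one_le_div hn0).2 hnx))
    have hH1le : ∑ n ∈ Icc 1 ⌊x⌋₊, |W n| * mainConst n * Real.log (x / n) ≤ H₀ * ℓ := by
      rw [hH₀, Finset.sum_mul]
      refine Finset.sum_le_sum fun n hn ↦ ?_
      have hn' := Finset.mem_Icc.1 hn
      have hn0 : (0 : ℝ) < n := by exact_mod_cast hn'.1
      have hn1 : (1 : ℝ) ≤ n := by exact_mod_cast hn'.1
      refine mul_le_mul_of_nonneg_left ?_ (mul_nonneg (abs_nonneg _) (mainConst_nonneg n))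
      exact Real.log_le_log (div_pos hx0 hn0) (div_le_self hx0.le hn1)
    calc |∑ n ∈ Icc 1 ⌊x⌋₊, |W n| * mainConst n * Real.log (x / n) - π ^ 2 / 6 * ℓ ^ 2 / 2|
        ≤ |∑ n ∈ Icc 1 ⌊x⌋₊, |W n| * mainConst n * Real.log (x / n)| + |π ^ 2 / 6 * ℓ ^ 2 / 2| := abs_sub _ _
      _ = ∑ n ∈ Icc 1 ⌊x⌋₊, |W n| * mainConst n * Real.log (x / n) + π ^ 2 / 6 * ℓ ^ 2 / 2 := by
          rw [abs_of_nonneg hH1, abs_of_nonneg (by positivity)]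
      _ ≤ C_c * (2 + ℓ) * ℓ + π ^ 2 / 6 * ℓ ^ 2 / 2 := by nlinarith
      _ ≤ C_c * (2 + 2) * 2 + π ^ 2 / 6 * 2 ^ 2 / 2 := by
          have : C_c * (2 + ℓ) * ℓ ≤ C_c * (2 + 2) * 2 := by
            have h4 : (2 + ℓ) * ℓ ≤ (2 + 2) * 2 := by nlinarith
            nlinarith
          have : ℓ ^ 2 ≤ 2 ^ 2 := pow_le_pow_left₀ hlx hl2 2
          nlinarith [Real.pi_pos, sq_nonneg π]
      _ ≤ (C₀ + |C_W3| / 2 + |C_W2| / 2 + C_δ / 2 + 8 * C_c + π ^ 2 / 6 * 2 + 1) * (1 + ℓ) := by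
          have h1 : 0 ≤ |C_W3| := abs_nonneg _
          have h2 : 0 ≤ |C_W2| := abs_nonneg _
          nlinarith [Real.pi_pos, sq_nonneg π]

end Summit.Parity.GeneralizedHardyLittlewood.Theorems.MomentsBeyondDiagonal.DiagKernel

end
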